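import Summits.Ventures.Crystal3D.Theorems.StickyWulffConstantPolycrystalWulffBoundBasalLamellarChimera
import Summits.Ventures.Crystal3D.Theorems.StickyWulffConstantPolycrystalWulffBoundMinkowskiUpper
import Summits.Ventures.Crystal3D.Theorems.StickyWulffConstantPolycrystalWulffBoundPolyClosure
import Summits.Ventures.Crystal3D.Theorems.StickyWulffConstantPolycrystalWulffBoundSeparated

/-!
# `PolycrystalWulffBound`, line `PolyDensity`: the rung `rung_basalLamellar` — basal-lamellar co-axial
# polyhedral textures satisfy the polycrystal Wulff bound (FREE energy alone)

Route `StickyWulffConstant` of the venture `Summits/Ventures/Crystal3D`, crux `PolycrystalWulffBound`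
(item `stmt-Ventures-19482`), second prover lane (poly-p2, gen 3).  The planner's rung
(`PolyDensityRungsDefFree.lean`, «THE WITNESS FOR THE TWIN PROBLEM»): a polyhedral set `E` of finite
volume cut by parallel planes `⊥ m` into lamellae `G_f = E ∩ {a_f < ⟪x,m⟫ < a_{f+1}}` with pairwise
co-axial frames `A_f` (axis `m`) has free energy `Fr ≥ 6·2^{1/3}(√2·Vol)^{2/3}`.
Proof (Brunn–Minkowski route, replacing the line card's Knothe map and ROUTE §72.6's lattice
discretisation): for small `r`, the chimera neighbourhood `C_r = ⋃_f (G_f + r·W(A_f))` satisfies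
`(|E'|^{1/3} + r·32^{1/3})³ ≤ |C_r|` (`lamellar_chimera_lower`: the SL line's chimera Brunn–Minkowski;
co-axial frames give bodies with equal horizontal sections) and `|C_r| ≤ |E'| + r·(Fr + ε)`
(`volume_chimera_texture_le`: polyhedral anisotropic Minkowski content by slab accounting on the
hyperplane arrangement + g2's exterior calculus); expand the cube and let `ε → 0`.
WHAT THIS IS NOT: a registered stub; the crux is not claimed.
-/

noncomputable section

open scoped BigOperators InnerProductSpace ENNReal Pointwise
open MeasureTheory Filter Set

namespace Summit.Ventures.Crystal3D.Cruxes.PolycrystalWulffBound.PolyDensity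

open Summit.Ventures.Crystal3D.Theorems
open Summit.Ventures.Crystal3D.Cruxes.TextureLiminf.TexShadow (per polytope E3)
open Literature.MathematicalPhysics.StatisticalMechanics (fccStacking barlowStacking IsHaggSeq perimeter)

/-- **Rung `rung_basalLamellar`** (planner's statement verbatim): basal-lamellar co-axial polyhedral
textures satisfy the polycrystal Wulff bound with the free energy alone. -/
theorem rung_basalLamellar : let Λ : Set (EuclideanSpace ℝ (Fin 3)) := Literature.MathematicalPhysics.StatisticalMechanics.fccStacking 1 (Real.sqrt (2 / 3)); let Brl : (ℤ → ℤ) → Set (EuclideanSpace ℝ (Fin 3)) := Literature.MathematicalPhysics.StatisticalMechanics.barlowStacking 1 (Real.sqrt (2 / 3)); let Ax : EuclideanSpace ℝ (Fin 3) → (EuclideanSpace ℝ (Fin 3) ≃ₗᵢ[ℝ] EuclideanSpace ℝ (Fin 3)) → (EuclideanSpace ℝ (Fin 3) ≃ₗᵢ[ℝ] EuclideanSpace ℝ (Fin 3)) → Prop := fun m A B => ∃ (L : EuclideanSpace ℝ (Fin 3) ≃ₗᵢ[ℝ] EuclideanSpace ℝ (Fin 3)) (s₁ s₂ : EuclideanSpace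 ℝ (Fin 3)) (σ σ' : ℤ → ℤ), Literature.MathematicalPhysics.StatisticalMechanics.IsHaggSeq σ ∧ Literature.MathematicalPhysics.StatisticalMechanics.IsHaggSeq σ' ∧ L (EuclideanSpace.single (2 : Fin 3) (1 : ℝ)) = m ∧ A '' Λ ⊆ (fun q => L q + s₁) '' Brl σ ∧ B '' Λ ⊆ (fun q => L q + s₂) '' Brl σ'; let Φ : EuclideanSpace ℝ (Fin 3) → ℝ := fun ν => Real.sqrt 2 / 4 * ∑ᶠ w ∈ {w ∈ Λ | ‖w‖ = 1}, |⟪w, ν⟫_ℝ|; let Per : Set (EuclideanSpace ℝ (Fin 3)) → Set (EuclideanSpace ℝ (Fin 3)) → ℝ := fun K S => (⨆ (ξ : EuclideanSpace ℝ (Fin 3) → EuclideanSpace ℝ (Fin 3)) (_ : ContDiff ℝ 1 ξ ∧ HasCompactSupport ξ ∧ ∀ z, ξ z ∈ K), ENNReal.ofReal (∫ z in S, Literature.MathematicalPhysics.StatisticalMechanics.fieldDivergence ξ z)).toReal; let ι : Set (EuclideanSpace ℝ (Fin 3)) → Set (EuclideanSpace ℝ (Fin 3)) → Set (EuclideanSpace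 ℝ (Fin 3)) → ℝ := fun K S₁ S₂ => (Per K S₁ + Per K S₂ - Per K (S₁ ∪ S₂)) / 2; let W : (EuclideanSpace ℝ (Fin 3) ≃ₗᵢ[ℝ] EuclideanSpace ℝ (Fin 3)) → Set (EuclideanSpace ℝ (Fin 3)) := fun A => {y | ∀ ν : EuclideanSpace ℝ (Fin 3), ⟪y, ν⟫_ℝ ≤ Φ (A.symm ν)}; let Vol : (n : ℕ) → (Fin n → Set (EuclideanSpace ℝ (Fin 3))) → ℝ := fun n G => (volume (⋃ f : Fin n, G f)).toReal; let Poly : Set (EuclideanSpace ℝ (Fin 3)) → Prop := fun S => ∃ (k : ℕ) (H : Fin k → Finset ((EuclideanSpace ℝ (Fin 3)) × ℝ)), S = ⋃ i, ⋂ p ∈ H i, {x | ⟪p.1, x⟫_ℝ < p.2}; let Fr : (n : ℕ) → (Fin n → Set (EuclideanSpace ℝ (Fin 3))) → (Fin n → (EuclideanSpace ℝ (Fin 3) ≃ₗᵢ[ℝ] EuclideanSpace ℝ (Fin 3))) → ℝ := fun n G A => ∑ f : Fin n, Per (W (A f)) (G f) - ∑ f, ∑ g, (if f = g then 0 else ι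 (W (A f)) (G f) (G g)); ∀ (E : Set (EuclideanSpace ℝ (Fin 3))), Poly E → volume E < ⊤ → ∀ (m : EuclideanSpace ℝ (Fin 3)), ‖m‖ = 1 → ∀ (n : ℕ) (a : Fin (n + 1) → ℝ), StrictMono a → ∀ (A : Fin n → (EuclideanSpace ℝ (Fin 3) ≃ₗᵢ[ℝ] EuclideanSpace ℝ (Fin 3))), (∀ f g, Ax m (A f) (A g)) → 6 * (2 : ℝ) ^ ((1 : ℝ) / 3) * (Real.sqrt 2 * Vol n (fun f => E ∩ {x | a f.castSucc < ⟪x, m⟫_ℝ ∧ ⟪x, m⟫_ℝ < a f.succ})) ^ ((2 : ℝ) / 3) ≤ Fr n (fun f => E ∩ {x | a f.castSucc < ⟪x, m⟫_ℝ ∧ ⟪x, m⟫_ℝ < a f.succ}) A := by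
  intro Λ Brl Ax Φ Per ι W Vol Poly Fr E hE hEv m hm n a ha A hAx
  classical
  -- the lamellae
  set slab : Fin n → Set E3 := fun f => {x : E3 | a f.castSucc < ⟪x, m⟫_ℝ ∧ ⟪x, m⟫_ℝ < a f.succ}
    with hslab
  set G : Fin n → Set E3 := fun f => E ∩ slab f with hG
  show 6 * (2 : ℝ) ^ ((1 : ℝ) / 3) * (Real.sqrt 2 * (volume (⋃ f, G f)).toReal) ^ ((2 : ℝ) / 3) ≤
    (∑ f, Per (W (A f)) (G f)) - ∑ f, ∑ g, (if f = g then 0 else ι (W (A f)) (G f) (G g))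
  rw [← Finset.sum_sub_distrib]
  have hPolyG : ∀ f, ∃ (k : ℕ) (H : Fin k → Finset (E3 × ℝ)), G f = ⋃ i, polytope (H i) :=
    fun f => poly_inter_slab hE m (a f.castSucc) (a f.succ)
  have hvolG : ∀ f, volume (G f) < ⊤ := fun f => lt_of_le_of_lt (measure_mono inter_subset_left) hEv
  have hdisjG : ∀ f g, f ≠ g → Disjoint (G f) (G g) := by
    intro f g hfg
    rw [Set.disjoint_left]
    rintro x ⟨-, hxf⟩ ⟨-, hxg⟩
    exact hfg (lamella_index_unique ha hxf hxg)
  -- bodies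
  have hWc : ∀ f, IsCompact (W (A f)) := fun f => isCompact_cruxWulffBody (A f)
  have hWv : ∀ f, Convex ℝ (W (A f)) := fun f => convex_cruxWulffBody (A f)
  have hW0 : ∀ f, (0 : E3) ∈ W (A f) := fun f => zero_mem_cruxWulffBody (A f)
  have hWs : ∀ f, -W (A f) = W (A f) := fun f => neg_cruxWulffBody_eq (A f)
  -- the free energy is nonnegative (`Fr ≥ √3·Per(E')`)
  have hFr0 : 0 ≤ ∑ f, (Per (W (A f)) (G f) - ∑ g, (if f = g then 0 else ι (W (A f)) (G f) (G g))) := by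
    have h := freeEnergy_ge_mul_perimeter G hPolyG hvolG hdisjG (fun f => W (A f)) hWc hWv hW0 hWs
      (Real.sqrt_pos.2 (by norm_num : (0:ℝ) < 3)) (fun f => closedBall_subset_cruxWulffBody (A f))
    exact le_trans (mul_nonneg (Real.sqrt_nonneg 3) ENNReal.toReal_nonneg) h
  set V : ℝ := (volume (⋃ f, G f)).toReal with hV
  have hV0 : 0 ≤ V := ENNReal.toReal_nonneg
  set F : ℝ := ∑ f, (Per (W (A f)) (G f) - ∑ g, (if f = g then 0 else ι (W (A f)) (G f) (G g))) with hF
  -- measurability / finiteness of `E' = ⋃ G f`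
  have hslabm : ∀ f, MeasurableSet (slab f) := fun f =>
    (continuous_id.inner continuous_const).measurable (measurableSet_Ioo (a := a f.castSucc) (b := a f.succ))
  have hEopen : IsOpen E := by
    obtain ⟨k, H, rfl⟩ := hE
    exact isOpen_iUnion fun i => isOpen_biInter_finset fun q _ =>
      isOpen_lt (continuous_const.inner continuous_id) continuous_const
  have hEm : MeasurableSet E := hEopen.measurableSet
  have hE'top : volume (⋃ f, G f) ≠ ⊤ :=
    (lt_of_le_of_lt (measure_mono (iUnion_subset fun f => inter_subset_left)) hEv).ne
  by_cases hE'0 : volume (⋃ f, G f) = 0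
  · -- empty texture: the bound is `0 ≤ Fr`
    have hV00 : V = 0 := by rw [hV, hE'0, ENNReal.toReal_zero]
    rw [hV00, mul_zero, Real.zero_rpow (by norm_num), mul_zero]
    exact hFr0
  -- `E` is bounded, hence so are the chimera neighbourhoods
  have hEbd : Bornology.IsBounded E := by
    obtain ⟨k, H, hEeq⟩ := hE
    rw [hEeq]
    refine Bornology.isBounded_iUnion.2 fun i => isBounded_hPolyhedron_of_volume_lt_top (H i) ?_
    exact lt_of_le_of_lt (measure_mono (by
      rw [hEeq]; exact subset_iUnion (fun i => ⋂ p ∈ H i, {x : E3 | ⟪p.1, x⟫_ℝ < p.2}) i)) hEv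
  -- the chimera neighbourhood of radius `r`
  have key : ∀ ε : ℝ, 0 < ε → 3 * (32 : ℝ) ^ ((3 : ℝ)⁻¹) * (V ^ ((3 : ℝ)⁻¹)) ^ 2 ≤ F + ε := by
    intro ε hε
    obtain ⟨r₀, hr₀, hup⟩ := volume_chimera_texture_le G hPolyG hvolG hdisjG (fun f => W (A f))
      hWc hWv hW0 hWs hε
    set r : ℝ := r₀ / 2 with hr
    have hr0 : 0 < r := by positivity
    have hrr₀ : r < r₀ := by rw [hr]; linarith
    set C : Set E3 := ⋃ f, ⋃ x ∈ G f, x +ᵥ (r • W (A f)) with hC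
    -- `C` is open (a union of translates of the open lamellae), hence measurable
    have hCopen : IsOpen C := by
      have hGo : ∀ f, IsOpen (G f) := fun f => hEopen.inter
        ((continuous_id.inner continuous_const).isOpen_preimage _ isOpen_Ioo)
      have hCeq : C = ⋃ f, ⋃ w ∈ r • W (A f), (fun x => x + w) '' G f := by
        ext y
        simp only [hC, mem_iUnion, Set.mem_vadd_set, vadd_eq_add, mem_image, exists_prop]
        constructor
        · rintro ⟨f, x, hx, w, hw, rfl⟩; exact ⟨f, w, hw, x, hx, rfl⟩
        · rintro ⟨f, w, hw, x, hx, rfl⟩; exact ⟨f, x, hx, w, hw, rfl⟩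
      rw [hCeq]
      exact isOpen_iUnion fun f => isOpen_biUnion fun w _ => (isOpenMap_add_right w) _ (hGo f)
    have hCm : MeasurableSet C := hCopen.measurableSet
    -- `C` is bounded, hence of finite volume
    have hCfin : volume C ≠ ⊤ := by
      obtain ⟨R₁, hR₁⟩ := hEbd.subset_closedBall 0
      have hCsub : C ⊆ Metric.closedBall (0 : E3) (R₁ + r * Real.sqrt 5) := by
        intro y hy
        simp only [hC, mem_iUnion, Set.mem_vadd_set, vadd_eq_add, exists_prop] at hy
        obtain ⟨f, x, hx, w, hw, rfl⟩ := hy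
        obtain ⟨w', hw', rfl⟩ := Set.mem_smul_set.1 hw
        have hx' : ‖x‖ ≤ R₁ := mem_closedBall_zero_iff.1 (hR₁ hx.1)
        have hw'' : ‖w'‖ ≤ Real.sqrt 5 := mem_closedBall_zero_iff.1 (cruxWulffBody_subset_closedBall (A f) hw')
        rw [mem_closedBall_zero_iff]
        calc ‖x + r • w'‖ ≤ ‖x‖ + ‖r • w'‖ := norm_add_le _ _
          _ = ‖x‖ + r * ‖w'‖ := by rw [norm_smul, Real.norm_of_nonneg hr0.le]
          _ ≤ R₁ + r * Real.sqrt 5 := by gcongr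
      exact (lt_of_le_of_lt (measure_mono hCsub) measure_closedBall_lt_top).ne
    -- lower bound (chimera) and upper bound (Minkowski content)
    have hlow := lamellar_chimera_lower m a ha E hEm A (fun f => hAx f f) hE'0 hE'top hr0 hCm
      (fun f x hx w hw => mem_iUnion.2 ⟨f, mem_iUnion₂.2 ⟨x, hx,
        Set.mem_vadd_set.2 ⟨r • w, Set.smul_mem_smul_set hw, rfl⟩⟩⟩)
    have hupC : (volume C).toReal ≤ V + r * (F + ε) := hup r hr0 hrr₀
    -- to real numbers
    set c : ℝ := (32 : ℝ) ^ ((3 : ℝ)⁻¹) with hc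
    have hc0 : 0 ≤ c := by positivity
    have hexp : (((3 : ℕ) : ℝ)⁻¹) = (3 : ℝ)⁻¹ := by norm_num
    have h1 : V ^ ((3 : ℝ)⁻¹) + r * c ≤ (volume C).toReal ^ ((3 : ℝ)⁻¹) := by
      have h := ENNReal.toReal_mono (ENNReal.rpow_ne_top_of_nonneg (by positivity) hCfin) hlow
      rw [ENNReal.toReal_add (ENNReal.rpow_ne_top_of_nonneg (by positivity) hE'top)
          (ENNReal.mul_ne_top ENNReal.ofReal_ne_top (ENNReal.rpow_ne_top_of_nonneg (by positivity)
            ENNReal.ofReal_ne_top)),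
        ENNReal.toReal_mul, ENNReal.toReal_ofReal hr0.le, ← ENNReal.toReal_rpow, ← ENNReal.toReal_rpow,
        ← ENNReal.toReal_rpow, ENNReal.toReal_ofReal (by norm_num : (0:ℝ) ≤ 32), hexp] at h
      exact h
    -- cube: `(V^{1/3} + r c)³ ≤ |C| ≤ V + r (F + ε)`
    set x : ℝ := V ^ ((3 : ℝ)⁻¹) with hx
    have hx0 : 0 ≤ x := by positivity
    have hx3 : x ^ 3 = V := by
      rw [hx, show ((3 : ℝ)⁻¹) = ((3 : ℕ) : ℝ)⁻¹ by norm_num]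
      exact Real.rpow_inv_natCast_pow hV0 (by norm_num)
    have hC3 : ((volume C).toReal ^ ((3 : ℝ)⁻¹)) ^ 3 = (volume C).toReal := by
      rw [show ((3 : ℝ)⁻¹) = ((3 : ℕ) : ℝ)⁻¹ by norm_num]
      exact Real.rpow_inv_natCast_pow ENNReal.toReal_nonneg (by norm_num)
    have h2 : (x + r * c) ^ 3 ≤ V + r * (F + ε) := by
      calc (x + r * c) ^ 3 ≤ ((volume C).toReal ^ ((3 : ℝ)⁻¹)) ^ 3 := by
            gcongr
        _ = (volume C).toReal := hC3
        _ ≤ V + r * (F + ε) := hupC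
    -- drop the higher-order terms and divide by `r`
    have h3 : r * (3 * c * x ^ 2) ≤ r * (F + ε) := by
      nlinarith [hx3, h2, hx0, hc0, hr0.le, mul_nonneg (mul_nonneg hr0.le hc0) (mul_nonneg hr0.le hc0),
        pow_nonneg (mul_nonneg hr0.le hc0) 3, mul_nonneg hx0 (mul_nonneg (mul_nonneg hr0.le hc0) (mul_nonneg hr0.le hc0))]
    have h4 : 3 * c * x ^ 2 ≤ F + ε := le_of_mul_le_mul_left h3 hr0
    linarith
  rw [wulff_constant_eq hV0]
  exact le_of_forall_pos_le_add key

end Summit.Ventures.Crystal3D.Cruxes.PolycrystalWulffBound.PolyDensity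

end
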